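import Summits.QuantumFields.YangMills.Theorems.ColdStartUniversalityColdStartSolutionsExistTangentTools
import Summits.QuantumFields.YangMills.Theorems.ColdStartUniversalityColdStartSolutionsExistGaussSums
import Literature.Probability.Process.ItoIntegralConstruction
import Literature.Probability.Process.BrownianQuadraticSums
import Literature.Analysis.FunctionSpaces.ItoProcessesProofs
import HarnessLib

/-!
# SCAFFOLD (work file, sorries allowed) — stub B1 `stub_tangentSumSq` of crux S (stmt-QuantumFields-24811),
# line `piwiener`: "tangent Itô systems keep the sum of squares" (statement = skeleton v7 `__Registered.stub_tangentSumSq`)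

Plan (lead `ym-line-csu-p1`, g2; see NOTES.md `## B1 plan`).  Fix a dyadic time `t = m₀/2^{n₀}`; at dyadic
level `n ≥ n₀` the grid `g j = j/2ⁿ`, `j ≤ N = m₀ 2^{n−n₀}`, has `g N = t`.  With the martingale versions
`J'` of the Itô integrals, the sampled step processes `σₙ = sample σ n` (values `σ̃_j = clamp n (σ (g j))`)
and the SAMPLING-ERROR MARTINGALES `Ĩ = J' − σₙ·W` (…TangentSample), on the a.s. event of the integral
equations and continuous paths one has the EXACT identity (`telescope_sq`, …TangentGrid)
  `Σ_k Y_k(t)² − Σ_k y_k² = Σ_{j<N} Σ_k [2 Y_k(g j) Δ_jY_k + (Δ_jY_k)²]`,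
  `Δ_jY_k = Δ_jA_k + Σ_n' (Δ_jĨ_{k,n'} + σ̃_{k,n',j} Δ_jW^{c n'})`, `A_k = ∫ b_k`.
On `{sup_{s≤t}|Y| ≤ C} ∩ {sup_{s≤t}|σ| ≤ n}` the tangency identities at the grid points turn the right side
into   PATH_n + II_n + QERR_n + GAUSS_n   where
* PATH_n  = Σ_j ∫_{cell j} [Σ_k 2(Y_k(g j) − Y_k(s)) b_k(s) + Σ_{k,n'} (σ̃² − σ_{k,n'}(s)²)] ds → 0 pathwise
  (T1; uniform continuity on `[0,t]`)                                          [`tangent_path_term`]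
* II_n    = 2 Σ_{k,n'} ((sample (clamp C ∘ Y_k) n)·Ĩ_{k,n'})_t, `E II² ≲ C² E∫(σ−σₙ)² → 0`
  (T2 at grid points; `integral_sq_sample_integral_le`, `samplingErr_facts`, `sqErr_sample_tendsto_zero`)
* QERR_n  = Σ_k Σ_j [r_j² + 2 r_j m_j], r_j = Δ_jA_k + Σ_n' Δ_jĨ, m_j = Σ_n' σ̃ Δ_jW: → 0 in probability
  (`Σ(ΔA)² → 0` pathwise; `E Σ(ΔĨ)² ≤ 4E∫(σ−σₙ)²` by `integral_quadSum_samplingErr_le`; Cauchy–Schwarz with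
  `E Σ_j m_j² ≤ |κ| t E sup σ²` uniformly in n)                                 [`tangent_qerr_term`]
* GAUSS_n = Σ_k [Σ_n' Σ_j σ̃²((Δ_jW)² − 2⁻ⁿ) + Σ_{n'≠n''} Σ_j σ̃σ̃ Δ_jW^{c n'} Δ_jW^{c n''}] → 0 in L²
  (`gaussSum_compSq_sq_le`, `gaussSum_cross_sq_le` with weights bounded by n²: bound `≲ n⁴ t 2⁻ⁿ`).
Finally `P(|Φ(t)−Φ(0)| ≥ δ) ≤ P(sup|Y| > C) + limsup_n [P(sup|σ| > n) + P(|terms| ≥ δ/4)] = P(sup|Y| > C)`,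
then `C → ∞`; dyadic `t` are dense and `Φ` is continuous a.s.
-/

set_option autoImplicit false

noncomputable section

namespace Summit.QuantumFields.YangMills.Theorems.ColdStartUniversality

open MeasureTheory ProbabilityTheory Filter Topology Finset
open scoped NNReal ENNReal BigOperators
open Literature.Probability.Process Literature.Analysis.FunctionSpaces

/-- **B1 (TARGET = skeleton v7 `__Registered.stub_tangentSumSq`)**: tangent Itô systems keep the sum of
squares. SCAFFOLD: proof outline above; sub-steps to be landed as helpers. -/
theorem tangentSumSq :
    ∀ {Ω : Type} [MeasurableSpace Ω] {P : Measure Ω} [IsProbabilityMeasure P] {d : ℕ}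
      {W : ℝ≥0 → Ω → (Fin d → ℝ)} (hW : IsBrownianVec W P) {ι κ : Type} [Fintype ι] [Fintype κ]
      (c : κ → Fin d) (_hc : Function.Injective c)
      (Y : ι → ℝ≥0 → Ω → ℝ) (b : ι → ℝ≥0 → Ω → ℝ) (σ : ι → κ → ℝ≥0 → Ω → ℝ)
      (J : ι → κ → ℝ≥0 → Ω → ℝ) (y₀ : ι → ℝ),
      (∀ k, IsStronglyProgressive hW.natFiltration (Y k)) →
      (∀ k, IsStronglyProgressive hW.natFiltration (b k)) →
      (∀ k n, IsStronglyProgressive hW.natFiltration (σ k n)) →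
      (∀ᵐ ω ∂P, ∀ k, Continuous fun t => Y k t ω) →
      (∀ᵐ ω ∂P, ∀ k, Continuous fun t => b k t ω) →
      (∀ᵐ ω ∂P, ∀ k n, Continuous fun t => σ k n t ω) →
      (∀ k n (t : ℝ≥0), sqErr (σ k n) 0 P t ≠ ⊤) →
      (∀ k n (t : ℝ≥0), ∫⁻ ω, ⨆ s ∈ Set.Iic t, ENNReal.ofReal (σ k n s ω ^ 2) ∂P < ⊤) →
      (∀ k n, IsItoIntegral (σ k n) (fun t ω => W t ω (c n)) (J k n) hW.natFiltration P) →
      (∀ᵐ ω ∂P, ∀ (t : ℝ≥0) (k : ι),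
        Y k t ω = y₀ k + (∫ s in (0 : ℝ)..t, b k s.toNNReal ω) + ∑ n, J k n t ω) →
      (∀ (t : ℝ≥0) (ω : Ω), 2 * ∑ k, Y k t ω * b k t ω + ∑ k, ∑ n, σ k n t ω ^ 2 = 0) →
      (∀ (t : ℝ≥0) (ω : Ω) (n : κ), ∑ k, Y k t ω * σ k n t ω = 0) →
      ∀ᵐ ω ∂P, ∀ t : ℝ≥0, ∑ k, Y k t ω ^ 2 = ∑ k, y₀ k ^ 2 := by
  intro Ω _ P _ d W hW ι κ _ _ c hc Y b σ J y₀ hYp hbp hσp hYc hbc hσc hσ2 hσsup hJ hEq hT1 hT2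
  -- Step 0: martingale versions `J'` of the Itô integrals (`exists_isItoIntegral_coord` + `IsItoIntegral.unique_holds`);
  --         the equations hold with `J'` a.s.
  -- Step 1: it suffices to prove `Σ Y_k(t)² = Σ y_k²` a.s. for each DYADIC `t = m₀/2^{n₀}` (countably many), then use the
  --         a.s. continuity of `t ↦ Σ_k Y_k(t)²` and density of dyadic rationals in `ℝ≥0`
  --         (`Continuous.ext_on` as in `vecPicard_lim_eq_step`).
  -- Step 2: fixed dyadic `t`: for every `C : ℕ`, `P(δ ≤ |Σ Y(t)² − Σ y²|) ≤ P(C < sup_{s≤t} max_k |Y_k s|)` by letting `n → ∞`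
  --         in the decomposition PATH + II + QERR + GAUSS (each → 0 in probability; tools listed in the header).
  -- Step 3: `C → ∞`.
  sorry

end Summit.QuantumFields.YangMills.Theorems.ColdStartUniversality

end
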